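import Literature.NumberTheory.LFunctions.WeilDilationVirial
import Literature.NumberTheory.LFunctions.WeilExplicitArchTermProofs
import HarnessLib

/-!
# First variation of the Weil functional under rescaling of the test function

Sibling of `Literature/NumberTheory/LFunctions/WeilExplicit.lean` (same normalisation:
`W = weilFunctional = polar - prime + archimedean`, test functions `IsWeilTest`). For a test
function `k` and a rescaling parameter `c > 0` put `k_c(t) = k(c t)`. We prove that
`c ↦ W(k_c)` is differentiable at every `c₀ > 0` with

  `d/dc|_{c₀} W(k(c ·)) = W(t ↦ t k'(c₀ t))`      (`hasDerivAt_weilFunctional_comp_mul`),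

termwise:
* polar term `k̂_c(0) + k̂_c(1)`: differentiation of `k̂_c(s) = ∫ k(ct) e^{(s-1/2)t} dt` under the
  integral sign (`hasDerivAt_weilMellin_comp_mul`; dominated on `|c - c₀| < c₀/2` by a constant
  multiple of the indicator of `[-R, R]`, `R = 2A/c₀`, `A` a support radius of `k`);
* prime term: on `|c - c₀| < c₀/2` it is a FIXED finite sum `Σ_{n<N} Λ(n) n^{-1/2}(k(c log n) +
  k(-c log n))` of differentiable functions of `c` (`hasDerivAt_weilPrimeTerm_comp_mul`);
* archimedean term: in Bombieri's form
  `W_∞(g) = -((log 4π + γ) g(0) + ∫₀^∞ (e^{x/2}(g(x) + g(-x)) - 2g(0)) dx/(2 sinh x))`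
  (`weilArchTermBombieri`, equal to the digamma form on test functions by the tree theorem
  `weilArchTermBombieri_eq_weilArchTerm_holds`, Bombieri 2000 eq. (2.8)) the parameter `c` sits
  inside `k` only, and the `c`-derivative of the integrand, `e^{x/2} x (k'(cx) - k'(-cx))/(2 sinh x)`,
  is bounded by `‖k'‖_∞ e^{R/2}` (`x ≤ sinh x`) and vanishes for `x > R`
  (`hasDerivAt_weilArchTermBombieri_comp_mul`, `hasDerivAt_weilArchTerm_comp_mul`).

This is the calculus behind the "Hadamard / dilation variation" of route
`RiemannHypothesis/WeilWindowFlow`; the dilation virial theorem for `Q(g_η)`,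
`g_η = weilDilate η g`, is deduced in `WeilDilationVirialDeriv.lean`. Everything is proved; no
named facts. [folklore] calculus; the dilation is E. Bombieri, Rend. Lincei (9) 11 (2000), §4,
proof of Thm 5.

## References

* E. Bombieri, *Remarks on Weil's quadratic functional in the theory of prime numbers I*, Atti
  Accad. Naz. Lincei Rend. Lincei (9) Mat. Appl. 11 (2000), 183–233, §2 eq. (2.8), §4 proof of Thm 5.
-/

noncomputable section

open Complex Filter Set MeasureTheory Metric
open scoped Real Topology ComplexConjugate ContDiff ArithmeticFunction.vonMangoldt

namespace Literature.NumberTheory.LFunctions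

variable {k : ℝ → ℂ}

/-! ## Elementary facts on test functions and their rescalings -/

/-- A test function and its derivative vanish outside a common radius: `k u = 0` and
`k' u = 0` for `|u| > A`. [folklore] -/
theorem exists_radius_of_isWeilTest (hk : IsWeilTest k) :
    ∃ A : ℝ, 0 ≤ A ∧ (∀ u : ℝ, A < |u| → k u = 0) ∧ ∀ u : ℝ, A < |u| → deriv k u = 0 := by
  obtain ⟨R, hR⟩ := hk.2.isCompact.isBounded.subset_closedBall 0
  refine ⟨|R|, abs_nonneg R, fun u hu ↦ ?_, fun u hu ↦ ?_⟩
  · refine image_eq_zero_of_notMem_tsupport fun hus ↦ ?_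
    have := hR hus
    rw [Metric.mem_closedBall, dist_zero_right, Real.norm_eq_abs] at this
    linarith [le_abs_self R]
  · have hsub : tsupport (deriv k) ⊆ tsupport k := tsupport_deriv_subset
    refine image_eq_zero_of_notMem_tsupport fun hus ↦ ?_
    have := hR (hsub hus)
    rw [Metric.mem_closedBall, dist_zero_right, Real.norm_eq_abs] at this
    linarith [le_abs_self R]

/-- A test function is bounded: `‖k u‖ ≤ K`. [folklore] -/
theorem exists_bound_of_isWeilTest (hk : IsWeilTest k) : ∃ K : ℝ, 0 ≤ K ∧ ∀ u : ℝ, ‖k u‖ ≤ K := by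
  obtain ⟨K, hK⟩ := hk.1.continuous.bounded_above_of_compact_support hk.2
  exact ⟨K, (norm_nonneg _).trans (hK 0), hK⟩

/-- Chain rule for the rescaling parameter: `d/dc k(c t) = t k'(c t)`. [folklore] -/
theorem hasDerivAt_comp_mul_param (hk : IsWeilTest k) (t c : ℝ) :
    HasDerivAt (fun c : ℝ ↦ k (c * t)) ((t : ℂ) * deriv k (c * t)) c := by
  have h1 : HasDerivAt (fun c : ℝ ↦ c * t) t c := by
    simpa using (hasDerivAt_id c).mul_const t
  have h2 : HasDerivAt k (deriv k (c * t)) (c * t) :=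
    (hk.1.differentiable (by simp) _).hasDerivAt
  have h := h2.scomp c h1
  simpa [Function.comp_def, Complex.real_smul] using h

/-- Chain rule in the variable: `(k(c ·))' t = c k'(c t)`. [folklore] -/
theorem deriv_comp_mul_of_isWeilTest (hk : IsWeilTest k) (c : ℝ) :
    deriv (fun t : ℝ ↦ k (c * t)) = fun t ↦ (c : ℂ) * deriv k (c * t) := by
  funext t
  have h1 : HasDerivAt (fun t : ℝ ↦ c * t) c t := by
    simpa using (hasDerivAt_id t).const_mul c
  have h2 : HasDerivAt k (deriv k (c * t)) (c * t) :=
    (hk.1.differentiable (by simp) _).hasDerivAt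
  have h := h2.scomp t h1
  simpa [Function.comp_def, Complex.real_smul] using h.deriv

/-- `t ↦ t k'(c₀ t)` is a test function (`c₀ ≠ 0`). [folklore] -/
theorem isWeilTest_ofReal_mul_deriv_comp_mul (hk : IsWeilTest k) {c₀ : ℝ} (hc₀ : c₀ ≠ 0) :
    IsWeilTest fun t : ℝ ↦ (t : ℂ) * deriv k (c₀ * t) :=
  (hk.deriv.comp_mul hc₀).ofReal_mul

/-- The prime term as a finite sum when the kernel vanishes for `|u| > R`. [folklore] -/
theorem weilPrimeTerm_eq_sum_of_radius {f : ℝ → ℂ} {R : ℝ} (hf : ∀ u : ℝ, R < |u| → f u = 0) :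
    weilPrimeTerm f = ∑ n ∈ Finset.range ⌈Real.exp (R + 1)⌉₊,
      ((Λ n : ℝ) : ℂ) / (Real.sqrt n : ℂ) * (f (Real.log n) + f (-Real.log n)) := by
  unfold weilPrimeTerm
  refine tsum_eq_sum fun n hn ↦ ?_
  rw [Finset.mem_range, not_lt] at hn
  have hn' : Real.exp (R + 1) ≤ n := (Nat.le_ceil _).trans (by exact_mod_cast hn)
  have hpos : (0 : ℝ) < n := (Real.exp_pos _).trans_le hn'
  have hlog : R + 1 ≤ Real.log n := by rwa [Real.le_log_iff_exp_le hpos]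
  have h1 : R < |Real.log n| := lt_of_lt_of_le (by linarith) (le_abs_self _)
  rw [hf _ h1, hf _ (by rwa [abs_neg]), add_zero, mul_zero]

/-! ## The transform of a rescaling, differentiated in the rescaling parameter -/

/-- **`d/dc (k(c ·))^(s) = (t ↦ t k'(c t))^(s)`** for a test function `k`, `c₀ > 0` and every
`s ∈ ℂ`: differentiation under the integral sign, dominated on the ball `|c - c₀| < c₀/2` by a
constant multiple of the indicator of `[-R, R]`, `R = 2A/c₀` (`A` a support radius of `k`).
[folklore] -/
theorem hasDerivAt_weilMellin_comp_mul (hk : IsWeilTest k) {c₀ : ℝ} (hc₀ : 0 < c₀) (s : ℂ) :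
    HasDerivAt (fun c : ℝ ↦ weilMellin (fun t ↦ k (c * t)) s)
      (weilMellin (fun t : ℝ ↦ (t : ℂ) * deriv k (c₀ * t)) s) c₀ := by
  obtain ⟨A, hA0, -, hAd⟩ := exists_radius_of_isWeilTest hk
  obtain ⟨K, hK0, hK⟩ := exists_bound_of_isWeilTest hk.deriv
  have hkc : Continuous k := hk.1.continuous
  have hdc : Continuous (deriv k) := hk.deriv.1.continuous
  set R : ℝ := 2 * A / c₀ with hR
  have hR0 : 0 ≤ R := by positivity
  have hAR : A = c₀ / 2 * R := by rw [hR]; field_simp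
  set B : ℝ := R * K * Real.exp (|s.re - 1 / 2| * R) with hB
  set F : ℝ → ℝ → ℂ := fun c t ↦ k (c * t) * cexp ((s - 1 / 2) * t) with hF
  set F' : ℝ → ℝ → ℂ := fun c t ↦ (t : ℂ) * deriv k (c * t) * cexp ((s - 1 / 2) * t) with hF'
  have hball : ball c₀ (c₀ / 2) ∈ 𝓝 c₀ := ball_mem_nhds c₀ (by positivity)
  have hF_meas : ∀ᶠ c in 𝓝 c₀, AEStronglyMeasurable (F c) volume :=
    Eventually.of_forall fun c ↦
      (by fun_prop : Continuous fun t : ℝ ↦ k (c * t) * cexp ((s - 1 / 2) * t)).aestronglyMeasurable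
  have hF_int : Integrable (F c₀) :=
    integrable_weilIntegrand (hk.comp_mul hc₀.ne').1.continuous (hk.comp_mul hc₀.ne').2 s
  have hF'_meas : AEStronglyMeasurable (F' c₀) volume :=
    (by fun_prop : Continuous fun t : ℝ ↦
      (t : ℂ) * deriv k (c₀ * t) * cexp ((s - 1 / 2) * t)).aestronglyMeasurable
  have h_bound : ∀ᵐ t : ℝ, ∀ c ∈ ball c₀ (c₀ / 2),
      ‖F' c t‖ ≤ (Icc (-R) R).indicator (fun _ ↦ B) t := by
    refine Eventually.of_forall fun t c hc ↦ ?_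
    have hc' : c₀ / 2 < c := by
      rw [mem_ball, Real.dist_eq] at hc
      linarith [neg_abs_le (c - c₀)]
    by_cases ht : t ∈ Icc (-R) R
    · rw [indicator_of_mem ht]
      have htabs : |t| ≤ R := abs_le.2 ⟨ht.1, ht.2⟩
      simp only [hF', norm_mul, Complex.norm_real, Real.norm_eq_abs, Complex.norm_exp]
      have hre : ((s - 1 / 2) * (t : ℂ)).re = (s.re - 1 / 2) * t := by simp [sub_re, mul_re]
      rw [hre]
      have h1 : (s.re - 1 / 2) * t ≤ |s.re - 1 / 2| * R := by
        calc (s.re - 1 / 2) * t ≤ |(s.re - 1 / 2) * t| := le_abs_self _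
          _ = |s.re - 1 / 2| * |t| := abs_mul _ _
          _ ≤ |s.re - 1 / 2| * R := mul_le_mul_of_nonneg_left htabs (abs_nonneg _)
      calc |t| * ‖deriv k (c * t)‖ * Real.exp ((s.re - 1 / 2) * t)
          ≤ R * K * Real.exp (|s.re - 1 / 2| * R) := by
            gcongr
            exact hK _
        _ = B := rfl
    · rw [indicator_of_notMem ht]
      have htabs : R < |t| := by
        simp only [mem_Icc, not_and_or, not_le] at ht
        rcases ht with h | h
        · exact lt_of_lt_of_le (by linarith) (neg_le_abs t)
        · exact lt_of_lt_of_le h (le_abs_self t)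
      have htpos : 0 < |t| := hR0.trans_lt htabs
      have hzero : deriv k (c * t) = 0 := by
        refine hAd _ ?_
        rw [abs_mul, abs_of_pos (by linarith)]
        calc A = c₀ / 2 * R := hAR
          _ ≤ c₀ / 2 * |t| := by gcongr
          _ < c * |t| := mul_lt_mul_of_pos_right hc' htpos
      simp [hF', hzero]
  have bound_integrable : Integrable ((Icc (-R) R).indicator fun _ : ℝ ↦ B) volume := by
    refine IntegrableOn.integrable_indicator ?_ measurableSet_Icc
    exact integrableOn_const (by simp)
  have h_diff : ∀ᵐ t : ℝ, ∀ c ∈ ball c₀ (c₀ / 2), HasDerivAt (F · t) (F' c t) c :=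
    Eventually.of_forall fun t c _ ↦
      (hasDerivAt_comp_mul_param hk t c).mul_const (cexp ((s - 1 / 2) * t))
  have key := hasDerivAt_integral_of_dominated_loc_of_deriv_le hball hF_meas hF_int hF'_meas
    h_bound bound_integrable h_diff
  exact key.2

/-- **The polar term of a rescaling, differentiated**:
`d/dc|_{c₀} [(k(c ·))^(0) + (k(c ·))^(1)] = (t ↦ t k'(c₀ t))^(0) + (t ↦ t k'(c₀ t))^(1)`.
[folklore] -/
theorem hasDerivAt_weilPolarTerm_comp_mul (hk : IsWeilTest k) {c₀ : ℝ} (hc₀ : 0 < c₀) :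
    HasDerivAt (fun c : ℝ ↦ weilPolarTerm (fun t ↦ k (c * t)))
      (weilPolarTerm (fun t : ℝ ↦ (t : ℂ) * deriv k (c₀ * t))) c₀ := by
  unfold weilPolarTerm
  exact (hasDerivAt_weilMellin_comp_mul hk hc₀ 0).add (hasDerivAt_weilMellin_comp_mul hk hc₀ 1)

/-! ## The prime term of a rescaling: a finite sum -/

/-- **The prime term of a rescaling, differentiated**: on `|c - c₀| < c₀/2` the prime sum of
`k(c ·)` is a FIXED finite sum (the kernel vanishes for `|u| > 2A/c₀`), each of whose terms is
differentiable in `c`; `d/dc|_{c₀} Σₙ Λ(n) n^{-1/2}(k(c log n) + k(-c log n))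
= Σₙ Λ(n) n^{-1/2}((D_{c₀}k)(log n) + (D_{c₀}k)(-log n))`, `(D_{c₀}k)(t) = t k'(c₀ t)`. [folklore] -/
theorem hasDerivAt_weilPrimeTerm_comp_mul (hk : IsWeilTest k) {c₀ : ℝ} (hc₀ : 0 < c₀) :
    HasDerivAt (fun c : ℝ ↦ weilPrimeTerm (fun t ↦ k (c * t)))
      (weilPrimeTerm (fun t : ℝ ↦ (t : ℂ) * deriv k (c₀ * t))) c₀ := by
  obtain ⟨A, hA0, hAk, hAd⟩ := exists_radius_of_isWeilTest hk
  set R : ℝ := 2 * A / c₀ with hR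
  have hR0 : 0 ≤ R := by positivity
  have hAR : A = c₀ / 2 * R := by rw [hR]; field_simp
  set N : ℕ := ⌈Real.exp (R + 1)⌉₊ with hN
  -- on the ball, the kernel `k(c ·)` vanishes for `|u| > R`
  have hvan : ∀ c ∈ ball c₀ (c₀ / 2), ∀ u : ℝ, R < |u| → k (c * u) = 0 := by
    intro c hc u hu
    have hc' : c₀ / 2 < c := by
      rw [mem_ball, Real.dist_eq] at hc
      linarith [neg_abs_le (c - c₀)]
    refine hAk _ ?_
    rw [abs_mul, abs_of_pos (by linarith)]
    calc A = c₀ / 2 * R := hAR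
      _ ≤ c₀ / 2 * |u| := by gcongr
      _ < c * |u| := mul_lt_mul_of_pos_right hc' (hR0.trans_lt hu)
  have hvan' : ∀ u : ℝ, R < |u| → (u : ℂ) * deriv k (c₀ * u) = 0 := by
    intro u hu
    have : deriv k (c₀ * u) = 0 := by
      refine hAd _ ?_
      rw [abs_mul, abs_of_pos hc₀]
      calc A = c₀ / 2 * R := hAR
        _ ≤ c₀ / 2 * |u| := by gcongr
        _ < c₀ * |u| := mul_lt_mul_of_pos_right (by linarith) (hR0.trans_lt hu)
    simp [this]
  -- the finite sum and its derivative
  have hsum : HasDerivAt (fun c : ℝ ↦ ∑ n ∈ Finset.range N,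
      ((Λ n : ℝ) : ℂ) / (Real.sqrt n : ℂ) * (k (c * Real.log n) + k (c * -Real.log n)))
      (∑ n ∈ Finset.range N, ((Λ n : ℝ) : ℂ) / (Real.sqrt n : ℂ) *
        (((Real.log n : ℝ) : ℂ) * deriv k (c₀ * Real.log n) +
          ((-Real.log n : ℝ) : ℂ) * deriv k (c₀ * -Real.log n))) c₀ := by
    refine HasDerivAt.fun_sum fun n _ ↦ ?_
    exact ((hasDerivAt_comp_mul_param hk (Real.log n) c₀).add
      (hasDerivAt_comp_mul_param hk (-Real.log n) c₀)).const_mul _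
  have heq : (fun c : ℝ ↦ weilPrimeTerm (fun t ↦ k (c * t))) =ᶠ[𝓝 c₀] fun c : ℝ ↦
      ∑ n ∈ Finset.range N,
        ((Λ n : ℝ) : ℂ) / (Real.sqrt n : ℂ) * (k (c * Real.log n) + k (c * -Real.log n)) := by
    filter_upwards [ball_mem_nhds c₀ (by positivity : (0 : ℝ) < c₀ / 2)] with c hc
    exact weilPrimeTerm_eq_sum_of_radius (hvan c hc)
  refine (hsum.congr_of_eventuallyEq heq).congr_deriv ?_
  rw [weilPrimeTerm_eq_sum_of_radius hvan']

/-! ## The archimedean term of a rescaling, in Bombieri's form -/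

/-- **The archimedean term of a rescaling, differentiated** — in Bombieri's form
`W_∞(g) = -((log 4π + γ) g(0) + ∫₀^∞ (e^{x/2}(g(x) + g(-x)) - 2 g(0)) dx/(2 sinh x))`
(`weilArchTermBombieri`), where for `g = k(c ·)` the parameter `c` sits inside `k` only:
`d/dc|_{c₀} W_∞(k(c ·)) = W_∞(t ↦ t k'(c₀ t))` (differentiation under the integral sign on
`(0, ∞)`: on `|c - c₀| < c₀/2` the `c`-derivative of the integrand,
`e^{x/2} x (k'(cx) - k'(-cx))/(2 sinh x)`, is bounded by `‖k'‖_∞ e^{x/2} x/sinh x ≤ ‖k'‖_∞ e^{R/2}`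
and vanishes for `x > R = 2A/c₀`). [folklore] -/
theorem hasDerivAt_weilArchTermBombieri_comp_mul (hk : IsWeilTest k) {c₀ : ℝ} (hc₀ : 0 < c₀) :
    HasDerivAt (fun c : ℝ ↦ weilArchTermBombieri (fun t ↦ k (c * t)))
      (weilArchTermBombieri (fun t : ℝ ↦ (t : ℂ) * deriv k (c₀ * t))) c₀ := by
  obtain ⟨A, hA0, -, hAd⟩ := exists_radius_of_isWeilTest hk
  obtain ⟨K, hK0, hK⟩ := exists_bound_of_isWeilTest hk.deriv
  have hkc : Continuous k := hk.1.continuous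
  have hdc : Continuous (deriv k) := hk.deriv.1.continuous
  set R : ℝ := 2 * A / c₀ with hR
  have hR0 : 0 ≤ R := by positivity
  have hAR : A = c₀ / 2 * R := by rw [hR]; field_simp
  set B : ℝ := K * Real.exp (R / 2) with hB
  set L : ℂ := (Real.log (4 * π) + Real.eulerMascheroniConstant : ℂ) with hL
  set F : ℝ → ℝ → ℂ := fun c x ↦
    ((Real.exp (x / 2) : ℂ) * (k (c * x) + k (c * -x)) - 2 * k 0) / (2 * Real.sinh x : ℂ) with hF
  set F' : ℝ → ℝ → ℂ := fun c x ↦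
    (Real.exp (x / 2) : ℂ) * ((x : ℂ) * deriv k (c * x) + ((-x : ℝ) : ℂ) * deriv k (c * -x)) /
      (2 * Real.sinh x : ℂ) with hF'
  set μ : Measure ℝ := volume.restrict (Ioi 0) with hμ
  -- (1) Bombieri's form for the rescalings and for the derivative kernel
  have hBomb : (fun c : ℝ ↦ weilArchTermBombieri (fun t ↦ k (c * t))) =
      fun c ↦ -(L * k 0 + ∫ x, F c x ∂μ) := by
    funext c
    simp only [weilArchTermBombieri, hF, hL, hμ, mul_zero]
  have hBombD : weilArchTermBombieri (fun t : ℝ ↦ (t : ℂ) * deriv k (c₀ * t)) = -(∫ x, F' c₀ x ∂μ) := by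
    simp only [weilArchTermBombieri, hF', hμ, Complex.ofReal_zero, zero_mul, mul_zero, sub_zero,
      zero_add, mul_div_assoc]
  -- (2) hypotheses of the dominated differentiation theorem
  have hball : ball c₀ (c₀ / 2) ∈ 𝓝 c₀ := ball_mem_nhds c₀ (by positivity)
  have hmeasF : ∀ c : ℝ, AEStronglyMeasurable (F c) μ := by
    intro c
    refine (Measurable.div ?_ ?_).aestronglyMeasurable
    · exact (by fun_prop : Continuous fun x : ℝ ↦
        (Real.exp (x / 2) : ℂ) * (k (c * x) + k (c * -x)) - 2 * k 0).measurable
    · exact (by fun_prop : Continuous fun x : ℝ ↦ (2 * Real.sinh x : ℂ)).measurable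
  have hF_meas : ∀ᶠ c in 𝓝 c₀, AEStronglyMeasurable (F c) μ := Eventually.of_forall hmeasF
  have hF'_meas : AEStronglyMeasurable (F' c₀) μ := by
    refine (Measurable.div ?_ ?_).aestronglyMeasurable
    · exact (by fun_prop : Continuous fun x : ℝ ↦ (Real.exp (x / 2) : ℂ) *
        ((x : ℂ) * deriv k (c₀ * x) + ((-x : ℝ) : ℂ) * deriv k (c₀ * -x))).measurable
    · exact (by fun_prop : Continuous fun x : ℝ ↦ (2 * Real.sinh x : ℂ)).measurable
  -- integrability of `F c₀` from the tree's majorant for the symmetrised kernel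
  have hF_int : Integrable (F c₀) μ := by
    have hk₂ : IsWeilTest (weilSymm fun t ↦ k (c₀ * t)) := (hk.comp_mul hc₀.ne').weilSymm
    have hmaj := integrableOn_bombieriMajorant hk₂
    refine Integrable.mono' hmaj (hmeasF c₀) ?_
    refine (ae_restrict_iff' measurableSet_Ioi).2 (Eventually.of_forall fun x (hx : 0 < x) ↦ ?_)
    have hsinh : 0 < Real.sinh x := Real.sinh_pos_iff.2 hx
    have hnum : (Real.exp (x / 2) : ℂ) * (k (c₀ * x) + k (c₀ * -x)) - 2 * k 0 =
        (Real.exp (x / 2) : ℂ) * weilSymm (fun t ↦ k (c₀ * t)) x - weilSymm (fun t ↦ k (c₀ * t)) 0 := by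
      simp only [weilSymm, mul_zero, neg_zero]
      ring
    have hden : ((2 : ℂ) * (Real.sinh x : ℂ)) = ((2 * Real.sinh x : ℝ) : ℂ) := by push_cast; ring
    simp only [hF]
    rw [hnum, hden, norm_div, Complex.norm_real, Real.norm_of_nonneg (by positivity)]
  have h_bound : ∀ᵐ x ∂μ, ∀ c ∈ ball c₀ (c₀ / 2), ‖F' c x‖ ≤ (Iic R).indicator (fun _ ↦ B) x := by
    refine (ae_restrict_iff' measurableSet_Ioi).2 (Eventually.of_forall fun x (hx : 0 < x) ↦ ?_)
    intro c hc
    have hc' : c₀ / 2 < c := by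
      rw [mem_ball, Real.dist_eq] at hc
      linarith [neg_abs_le (c - c₀)]
    have hcpos : 0 < c := by linarith
    have hsinh : 0 < Real.sinh x := Real.sinh_pos_iff.2 hx
    have hden : ((2 : ℂ) * (Real.sinh x : ℂ)) = ((2 * Real.sinh x : ℝ) : ℂ) := by push_cast; ring
    by_cases hxR : x ∈ Iic R
    · rw [indicator_of_mem hxR]
      have hxR' : x ≤ R := hxR
      have hxs : x ≤ Real.sinh x := Real.self_le_sinh_iff.2 hx.le
      have h1 : ‖(x : ℂ) * deriv k (c * x) + ((-x : ℝ) : ℂ) * deriv k (c * -x)‖ ≤ 2 * x * K := by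
        refine (norm_add_le _ _).trans ?_
        rw [norm_mul, norm_mul, Complex.norm_real, Complex.norm_real, Real.norm_eq_abs,
          Real.norm_eq_abs, abs_neg, abs_of_pos hx]
        have := hK (c * x)
        have := hK (c * -x)
        nlinarith
      simp only [hF']
      rw [hden, norm_div, norm_mul, Complex.norm_real, Complex.norm_real,
        Real.norm_of_nonneg (Real.exp_pos _).le, Real.norm_of_nonneg (by positivity),
        div_le_iff₀ (by positivity)]
      calc Real.exp (x / 2) * ‖(x : ℂ) * deriv k (c * x) + ((-x : ℝ) : ℂ) * deriv k (c * -x)‖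
          ≤ Real.exp (x / 2) * (2 * x * K) := by gcongr
        _ = K * Real.exp (x / 2) * (2 * x) := by ring
        _ ≤ K * Real.exp (R / 2) * (2 * Real.sinh x) := by gcongr
        _ = B * (2 * Real.sinh x) := by rw [hB]
    · rw [indicator_of_notMem hxR]
      have hxR' : R < x := lt_of_not_ge hxR
      have hz1 : deriv k (c * x) = 0 := by
        refine hAd _ ?_
        rw [abs_mul, abs_of_pos hcpos, abs_of_pos hx]
        calc A = c₀ / 2 * R := hAR
          _ ≤ c₀ / 2 * x := by gcongr
          _ < c * x := mul_lt_mul_of_pos_right hc' hx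
      have hz2 : deriv k (c * -x) = 0 := by
        refine hAd _ ?_
        rw [mul_neg, abs_neg, abs_mul, abs_of_pos hcpos, abs_of_pos hx]
        calc A = c₀ / 2 * R := hAR
          _ ≤ c₀ / 2 * x := by gcongr
          _ < c * x := mul_lt_mul_of_pos_right hc' hx
      have hz2' : deriv k (-(c * x)) = 0 := by rw [← mul_neg]; exact hz2
      simp [hF', hz1, hz2']
  have bound_integrable : Integrable ((Iic R).indicator fun _ : ℝ ↦ B) μ := by
    refine IntegrableOn.integrable_indicator ?_ measurableSet_Iic
    refine integrableOn_const ?_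
    rw [hμ, Measure.restrict_apply measurableSet_Iic]
    have : Iic R ∩ Ioi (0 : ℝ) = Ioc 0 R := by
      ext x; simp [and_comm]
    rw [this]
    simp
  have h_diff : ∀ᵐ x ∂μ, ∀ c ∈ ball c₀ (c₀ / 2), HasDerivAt (F · x) (F' c x) c :=
    Eventually.of_forall fun x c _ ↦
      ((((hasDerivAt_comp_mul_param hk x c).add (hasDerivAt_comp_mul_param hk (-x) c)).const_mul
        ((Real.exp (x / 2) : ℂ))).sub_const (2 * k 0)).div_const (2 * Real.sinh x : ℂ)
  have key := hasDerivAt_integral_of_dominated_loc_of_deriv_le hball hF_meas hF_int hF'_meas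
    h_bound bound_integrable h_diff
  -- (3) assemble
  rw [hBomb, hBombD]
  exact (key.2.const_add (L * k 0)).neg

/-- **The archimedean term of a rescaling, differentiated** (digamma form `weilArchTerm`, equal to
Bombieri's form on test functions by `weilArchTermBombieri_eq_weilArchTerm_holds`):
`d/dc|_{c₀} W_∞(k(c ·)) = W_∞(t ↦ t k'(c₀ t))`. [folklore] -/
theorem hasDerivAt_weilArchTerm_comp_mul (hk : IsWeilTest k) {c₀ : ℝ} (hc₀ : 0 < c₀) :
    HasDerivAt (fun c : ℝ ↦ weilArchTerm (fun t ↦ k (c * t)))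
      (weilArchTerm (fun t : ℝ ↦ (t : ℂ) * deriv k (c₀ * t))) c₀ := by
  have heq : (fun c : ℝ ↦ weilArchTerm (fun t ↦ k (c * t))) =ᶠ[𝓝 c₀]
      fun c ↦ weilArchTermBombieri (fun t ↦ k (c * t)) := by
    filter_upwards [Ioi_mem_nhds hc₀] with c hc
    exact (weilArchTermBombieri_eq_weilArchTerm_holds (hk.comp_mul (ne_of_gt hc))).symm
  refine ((hasDerivAt_weilArchTermBombieri_comp_mul hk hc₀).congr_of_eventuallyEq heq).congr_deriv ?_
  exact weilArchTermBombieri_eq_weilArchTerm_holds (isWeilTest_ofReal_mul_deriv_comp_mul hk hc₀.ne')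

/-! ## The Weil functional of a rescaling, differentiated -/

/-- **First variation of the Weil functional under rescaling.** For a test function `k` and
`c₀ > 0`, `c ↦ W(k(c ·))` is differentiable at `c₀` with derivative `W(t ↦ t k'(c₀ t))`
(sum of the polar, prime and archimedean variations). At `c₀ = 1` the derivative kernel is the
Euler generator `Dk = t k'` (`hasDerivAt_weilFunctional_comp_mul_one` in
`WeilDilationVirialDeriv.lean`). [folklore] -/
theorem hasDerivAt_weilFunctional_comp_mul (hk : IsWeilTest k) {c₀ : ℝ} (hc₀ : 0 < c₀) :
    HasDerivAt (fun c : ℝ ↦ weilFunctional (fun t ↦ k (c * t)))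
      (weilFunctional (fun t : ℝ ↦ (t : ℂ) * deriv k (c₀ * t))) c₀ := by
  unfold weilFunctional
  exact ((hasDerivAt_weilPolarTerm_comp_mul hk hc₀).sub (hasDerivAt_weilPrimeTerm_comp_mul hk hc₀)).add
    (hasDerivAt_weilArchTerm_comp_mul hk hc₀)

end Literature.NumberTheory.LFunctions

end
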